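import Mathlib

/-!
# Stub `stub_componentShape` — shape of a bounded component of `{G(x²) > 0}`
(crux `BiellipticRealPeriodCell`, stmt-KontsevichZagierPeriods-18685, line `Sketch`, stub A)

For `G ∈ ℚ[X]` with `F = G(X²)` squarefree and `q ∈ ℚ` with `F(q) > 0`, a BOUNDED connected
component `K` of the open set `{y : ℝ | F(y) > 0}` through `q` is an open interval `(α, β)`,
`α < β`, whose end points are roots of `F`; moreover `F(0) = G(0) ≠ 0` (else `X² ∣ F`), and `F`
is even, so a component containing `0` is symmetric: `α = −β`.

Elementary real analysis over Mathlib: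

* `boundedComponent_eq_Ioo` — an open, order-connected, bounded, nonempty subset of `ℝ` is
  `Ioo (sInf K) (sSup K)`; the ends are not in the open set `S` (a closed interval inside `S`
  meeting `K` lies in `K`) but lie in the closure of `K` (adapted from
  `XMapPeriodTransferCells.cellMonotone_component_shape`, which assumes `S` bounded below instead
  of `K` bounded);
* at an end point `F ≥ 0` by continuity and `¬ (F > 0)`, so `F = 0`;
* `F(0) ≠ 0`: `F(0) = G(0)`, and `G(0) = 0` gives `X ∣ G`, `X·X ∣ G(X²)`, contradicting
  squarefreeness (`X` is not a unit);
* symmetry: `−K` is preconnected, inside `{F > 0}` by evenness and contains `0 ∈ K`, so `−K ⊆ K`;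
  with `K = (α, β) ∋ 0` the points `−α`, `−β` force `α = −β`.

The hypothesis `G.natDegree = 3` of the registered signature is not used. No definitions are
introduced.

References: M. Kontsevich, D. Zagier, *Periods* (2001), §1.2.
-/

noncomputable section

open Polynomial Set

namespace Summit.KontsevichZagierPeriods.IsogenyCertificates.BiellipticRealPeriodCellStubs.ComponentShape

/-! ### Bounded open connected subsets of `ℝ` -/

-- adapted from Theorems/IsogenyCertificatesXMapPeriodTransferStubCellMonotone.lean
-- (`XMapPeriodTransferCells.cellMonotone_component_shape`)
/-- The connected component `K` of a point `x₀` of an open subset `S ⊆ ℝ`, if bounded, is an open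
interval `(α, β)` with `α < β`, whose ends are not in `S` but lie in the closure of `K`.
[folklore] -/
theorem boundedComponent_eq_Ioo {S : Set ℝ} (hS : IsOpen S) {x₀ : ℝ} (hx₀ : x₀ ∈ S)
    (hb : Bornology.IsBounded (connectedComponentIn S x₀)) :
    ∃ α β : ℝ, α < β ∧ connectedComponentIn S x₀ = Ioo α β ∧ α ∉ S ∧ β ∉ S ∧
      α ∈ closure (connectedComponentIn S x₀) ∧ β ∈ closure (connectedComponentIn S x₀) := by
  set K := connectedComponentIn S x₀ with hK
  have hKo : IsOpen K := hS.connectedComponentIn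
  have hx₀K : x₀ ∈ K := mem_connectedComponentIn hx₀
  have hKne : K.Nonempty := ⟨x₀, hx₀K⟩
  have hKb : BddBelow K := hb.bddBelow
  have hKa : BddAbove K := hb.bddAbove
  have hKoc : OrdConnected K :=
    isPreconnected_iff_ordConnected.mp isPreconnected_connectedComponentIn
  -- a closed interval inside `S` meeting `K` lies in `K`
  have hIccK : ∀ {a b y : ℝ}, Icc a b ⊆ S → y ∈ Icc a b → y ∈ K → Icc a b ⊆ K :=
    fun hab hy hyK => by
    have h := isPreconnected_Icc.subset_connectedComponentIn hy hab
    rwa [← connectedComponentIn_eq hyK] at h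
  -- an open set contains small open balls
  have hball : ∀ {T : Set ℝ} {z : ℝ}, IsOpen T → z ∈ T →
      ∃ ε > 0, Ioo (z - ε) (z + ε) ⊆ T := by
    intro T z hT hz
    obtain ⟨ε, hε, h⟩ := Metric.isOpen_iff.mp hT z hz
    exact ⟨ε, hε, by rwa [Real.ball_eq_Ioo] at h⟩
  -- the infimum `p`
  set p := sInf K with hp
  have hpK : ∀ y ∈ K, p ≤ y := fun y hy => csInf_le hKb hy
  have hp_not : p ∉ K := by
    intro hpK'
    obtain ⟨ε, hε, hsub⟩ := hball hKo hpK'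
    have hmem : p - ε / 2 ∈ K := hsub ⟨by linarith, by linarith⟩
    linarith [hpK _ hmem]
  have hlt_of_mem : ∀ y ∈ K, p < y := fun y hy =>
    lt_of_le_of_ne (hpK y hy) (fun h => hp_not (h ▸ hy))
  have hpS : p ∉ S := by
    intro hpS'
    obtain ⟨ε, hε, hsub⟩ := hball hS hpS'
    obtain ⟨y, hyK, hyε⟩ := exists_lt_of_csInf_lt hKne (lt_add_of_pos_right p hε)
    have hIcc : Icc p y ⊆ S := fun z hz => hsub ⟨by linarith [hz.1], by linarith [hz.2]⟩
    exact hp_not (hIccK hIcc ⟨hpK y hyK, le_rfl⟩ hyK ⟨le_rfl, hpK y hyK⟩)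
  -- the supremum `q`
  set q := sSup K with hq
  have hqK : ∀ y ∈ K, y ≤ q := fun y hy => le_csSup hKa hy
  have hq_not : q ∉ K := by
    intro hqK'
    obtain ⟨ε, hε, hsub⟩ := hball hKo hqK'
    have hmem : q + ε / 2 ∈ K := hsub ⟨by linarith, by linarith⟩
    linarith [hqK _ hmem]
  have hlt_of_mem' : ∀ y ∈ K, y < q := fun y hy =>
    lt_of_le_of_ne (hqK y hy) (fun h => hq_not (h ▸ hy))
  have hqS : q ∉ S := by
    intro hqS'
    obtain ⟨ε, hε, hsub⟩ := hball hS hqS'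
    obtain ⟨y, hyK, hyε⟩ := exists_lt_of_lt_csSup hKne (sub_lt_self q hε)
    have hIcc : Icc y q ⊆ S := fun z hz => hsub ⟨by linarith [hz.1], by linarith [hz.2]⟩
    exact hq_not (hIccK hIcc ⟨le_rfl, hqK y hyK⟩ hyK ⟨hqK y hyK, le_rfl⟩)
  refine ⟨p, q, (hlt_of_mem x₀ hx₀K).trans (hlt_of_mem' x₀ hx₀K), ?_, hpS, hqS,
    csInf_mem_closure hKne hKb, csSup_mem_closure hKne hKa⟩
  ext y
  refine ⟨fun hy => ⟨hlt_of_mem y hy, hlt_of_mem' y hy⟩, fun hy => ?_⟩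
  obtain ⟨c₁, hc₁K, hc₁y⟩ := exists_lt_of_csInf_lt hKne hy.1
  obtain ⟨c₂, hc₂K, hyc₂⟩ := exists_lt_of_lt_csSup hKne hy.2
  exact hKoc.out hc₁K hc₂K ⟨hc₁y.le, hyc₂.le⟩

/-! ### The even sextic `F = G(X²)` -/

/-- `F = G(X²)` is even: `F(−y) = F(y)`. [folklore] -/
theorem aeval_neg_comp_X_sq (G : ℚ[X]) (y : ℝ) :
    aeval (-y) (G.comp (X ^ 2)) = aeval y (G.comp (X ^ 2)) := by
  simp only [aeval_comp, map_pow, aeval_X, neg_sq]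

/-- If `F = G(X²)` is squarefree then `F(0) = G(0) ≠ 0`: otherwise `X ∣ G`, so `X·X ∣ G(X²)`
and `X` would be a unit. [folklore] -/
theorem aeval_zero_comp_X_sq_ne_zero (G : ℚ[X]) (hsq : Squarefree (G.comp (X ^ 2))) :
    aeval (0 : ℝ) (G.comp (X ^ 2)) ≠ 0 := by
  intro h0
  have h1 : algebraMap ℚ ℝ (G.coeff 0) = 0 := by
    rw [coeff_zero_eq_aeval_zero']
    simpa [aeval_comp] using h0
  have h2 : G.coeff 0 = 0 := by simpa using h1
  obtain ⟨H, hH⟩ := Polynomial.X_dvd_iff.mpr h2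
  have hdvd : X * X ∣ G.comp (X ^ 2) :=
    ⟨H.comp (X ^ 2), by rw [hH, mul_comp, X_comp, sq]⟩
  exact Polynomial.not_isUnit_X (hsq X hdvd)

/-- The positivity set `{F > 0}` of a rational polynomial on `ℝ` is open. [folklore] -/
theorem isOpen_aeval_pos (F : ℚ[X]) : IsOpen {y : ℝ | 0 < aeval y F} :=
  isOpen_lt continuous_const (Polynomial.continuous_aeval F)

/-- At a point of the closure of `{F > 0}` not in `{F > 0}`, `F` vanishes. [folklore] -/
theorem aeval_eq_zero_of_closure (F : ℚ[X]) {K : Set ℝ} {z : ℝ}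
    (hK : K ⊆ {y : ℝ | 0 < aeval y F}) (hz : z ∉ {y : ℝ | 0 < aeval y F})
    (hzK : z ∈ closure K) : aeval z F = 0 := by
  have h0 : 0 ≤ aeval z F := by
    have hsub : K ⊆ {y : ℝ | (fun _ => (0 : ℝ)) y < aeval y F} := hK
    exact (closure_mono hsub).trans
      (closure_lt_subset_le continuous_const (Polynomial.continuous_aeval F)) hzK
  have h1 : aeval z F ≤ 0 := not_lt.mp hz
  exact le_antisymm h1 h0

/-- An open interval `(α, β) ∋ 0` stable under `y ↦ −y` is symmetric: `α = −β`. [folklore] -/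
theorem Ioo_symmetric {α β : ℝ} (h0 : (0 : ℝ) ∈ Ioo α β)
    (hsym : ∀ y ∈ Ioo α β, -y ∈ Ioo α β) : α = -β := by
  obtain ⟨hα, hβ⟩ := h0
  refine le_antisymm (not_lt.mp fun h => ?_) (not_lt.mp fun h => ?_)
  · have h' := hsym (-α) ⟨by linarith, by linarith⟩
    rw [neg_neg] at h'
    exact lt_irrefl _ h'.1
  · have h' := hsym (-β) ⟨h, by linarith⟩
    rw [neg_neg] at h'
    exact lt_irrefl _ h'.2

/-! ### The stub -/

/-- **Registered stub `stub_componentShape`** (A — shape of a bounded component of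
`{G(x²) > 0}`). A bounded connected component `K` of the positivity set of the even polynomial
`F = G(X²)` (squarefree) through a point `q` with `F(q) > 0` is an open interval `(α, β)` whose
end points are roots of `F`; `F(0) ≠ 0`; and if `0 ∈ K` then `α = −β`. [folklore] -/
theorem stub_componentShape : ∀ (G : ℚ[X]) (q : ℚ), G.natDegree = 3 → Squarefree (G.comp (X ^ 2)) →
    0 < aeval (q : ℝ) (G.comp (X ^ 2)) →
    Bornology.IsBounded (connectedComponentIn {y : ℝ | 0 < aeval y (G.comp (X ^ 2))} (q : ℝ)) →
    ∃ α β : ℝ, α < β ∧ connectedComponentIn {y : ℝ | 0 < aeval y (G.comp (X ^ 2))} (q : ℝ) = Ioo α β ∧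
      aeval α (G.comp (X ^ 2)) = 0 ∧ aeval β (G.comp (X ^ 2)) = 0 ∧ aeval (0 : ℝ) (G.comp (X ^ 2)) ≠ 0 ∧
      ((0 : ℝ) ∈ Ioo α β → α = -β) := by
  intro G q _hdeg hsq hq hb
  have hS : IsOpen {y : ℝ | 0 < aeval y (G.comp (X ^ 2))} := isOpen_aeval_pos _
  have hKS : connectedComponentIn {y : ℝ | 0 < aeval y (G.comp (X ^ 2))} (q : ℝ) ⊆
      {y : ℝ | 0 < aeval y (G.comp (X ^ 2))} := connectedComponentIn_subset _ _
  obtain ⟨α, β, hαβ, hK, hαS, hβS, hαc, hβc⟩ := boundedComponent_eq_Ioo hS hq hb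
  refine ⟨α, β, hαβ, hK, aeval_eq_zero_of_closure _ hKS hαS hαc,
    aeval_eq_zero_of_closure _ hKS hβS hβc, aeval_zero_comp_X_sq_ne_zero G hsq, fun h0 => ?_⟩
  -- symmetry of a component through `0`
  refine Ioo_symmetric h0 fun y hy => ?_
  have h0K : (0 : ℝ) ∈ connectedComponentIn {y : ℝ | 0 < aeval y (G.comp (X ^ 2))} (q : ℝ) :=
    hK ▸ h0
  -- `-K` is preconnected, inside `{F > 0}`, and contains `0`
  have hpre : IsPreconnected ((fun y : ℝ => -y) '' Ioo α β) :=
    isPreconnected_Ioo.image _ continuous_neg.continuousOn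
  have hsub : (fun y : ℝ => -y) '' Ioo α β ⊆ {y : ℝ | 0 < aeval y (G.comp (X ^ 2))} := by
    rintro _ ⟨z, hz, rfl⟩
    show 0 < aeval (-z) (G.comp (X ^ 2))
    rw [aeval_neg_comp_X_sq]
    exact hKS (hK ▸ hz)
  have h0N : (0 : ℝ) ∈ (fun y : ℝ => -y) '' Ioo α β := ⟨0, h0, neg_zero⟩
  have hNK := hpre.subset_connectedComponentIn h0N hsub
  rw [← connectedComponentIn_eq h0K, hK] at hNK
  exact hNK ⟨y, hy, rfl⟩

end Summit.KontsevichZagierPeriods.IsogenyCertificates.BiellipticRealPeriodCellStubs.ComponentShape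

end
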